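import Literature.MathematicalPhysics.QuantumLattice.InfiniteVolumeStates
import HarnessLib

/-!
# Discharged fact: gapped ground states are antitone in the gap (`InfiniteVolumeStates`)

Fourth proof file of `Literature/MathematicalPhysics/QuantumLattice/InfiniteVolumeStates.lean`
(after `InfiniteVolumeStatesProofs.lean`, `InfiniteVolumeStatesDerivationProofs.lean` and
`InfiniteVolumeStatesGroundStateProofs.lean`, none of which it needs). It discharges the named
fact (`def X : Prop`, D-0014)

* `Literature.MathematicalPhysics.QuantumLattice.InfVolState.IsGappedGroundState.anti` —
  **gapped ground states are antitone in the gap constant**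
  (`InfVolState.IsGappedGroundState.anti_holds`): if `ω` is a gapped ground state of `Φ`
  (range `R`) with gap `γ`, i.e. `ω` is a ground state, `0 < γ`, and
  `γ (ω(A⋆A) - |ω(A)|²) ≤ -i ω(A⋆ δ(A))` for every local `A`, then the same holds for every
  `γ'` with `0 < γ' ≤ γ`.

No statement of `InfiniteVolumeStates` is changed and no definition or named fact is introduced.

## Proof of `IsGappedGroundState.anti_holds`

In Tasaki's formulation (2020, App. A.7, Def. A.16: the GNS Hamiltonian `H_ω ≥ 0` has the
non-degenerate eigenvalue `0` and `spec H_ω ∖ {0} ⊆ [γ, ∞)`) the monotonicity in `γ` is the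
inclusion `[γ, ∞) ⊆ [γ', ∞)`; for the vendored local (Bratteli–Robinson) criterion it is the
following two-line estimate. Fix a local `A ∈ 𝔄_Λ` and put `V = re ω(A⋆A) - |ω(A)|² ∈ ℝ`,
`z = -i ω(A⋆ δ(A)) ∈ ℂ`. The gap inequality is `(γ V : ℂ) ≤ z` and the ground-state inequality
(first conjunct of `IsGappedGroundState`) is `0 ≤ z`, both in Mathlib's `ComplexOrder`
(`w ≤ z ↔ re w ≤ re z ∧ im w = im z`, `Complex.le_def`); so `im z = 0`, `γ V ≤ re z` and
`0 ≤ re z`. If `V ≥ 0` then `γ' V ≤ γ V ≤ re z`; if `V < 0` then `γ' V < 0 ≤ re z` (`γ' > 0`).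
Hence `(γ' V : ℂ) ≤ z`. (Positivity of the variance `V ≥ 0`, i.e. Cauchy–Schwarz for states, is
not needed.)

## References

* H. Tasaki, *Physics and Mathematics of Quantum Many-Body Systems* (Graduate Texts in Physics,
  Springer 2020), doi:10.1007/978-3-030-41265-4, App. A.7, Def. A.16 (unique gapped ground state)
  and Lemma A.17 — the cite carried by the fact (not held locally; an acquisition request is on
  file from the earlier proof files; the discharge only uses the vendored statement).
  [Tasaki2020]
* O. Bratteli, D. W. Robinson, *Operator Algebras and Quantum Statistical Mechanics 2* (2nd ed.,
  Springer 1997), Def. 5.3.18 / Prop. 5.3.19, §6.2.7 (local ground-state criterion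
  `-i ω(A⋆δ(A)) ≥ 0`). [BratteliRobinsonII1997]
-/

open Matrix
open scoped ComplexOrder

namespace Literature.MathematicalPhysics.QuantumLattice

variable {d q : ℕ}

/-- **Gapped ground states are antitone in the gap** (discharge of the named fact
`InfVolState.IsGappedGroundState.anti`): a gapped ground state of `Φ` (range `R`) with gap `γ` is
a gapped ground state with every gap `0 < γ' ≤ γ`. With `V = re ω(A⋆A) - |ω(A)|²` and
`z = -i ω(A⋆ δ(A))`, the gap inequality gives `γ V ≤ re z`, the ground-state inequality gives
`0 ≤ re z` and `im z = 0` (`ComplexOrder`), hence `γ' V ≤ max (γ V) 0 ≤ re z` according to the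
sign of `V`. Tasaki (2020) App. A.7, Def. A.16 (`spec H_ω ∖ {0} ⊆ [γ, ∞) ⊆ [γ', ∞)`);
Bratteli–Robinson II Prop. 5.3.19. [cite: Tasaki2020, Def. A.16] -/
theorem InfVolState.IsGappedGroundState.anti_holds :
    InfVolState.IsGappedGroundState.anti (d := d) (q := q) := by
  intro ω Φ R γ γ' h hγ' hle
  refine ⟨h.1, hγ', fun Λ A => ?_⟩
  have h0 := h.1 Λ A
  have hγ := h.2.2 Λ A
  rw [Complex.le_def] at h0 hγ ⊢
  simp only [Complex.zero_re, Complex.zero_im, Complex.ofReal_re, Complex.ofReal_im] at h0 hγ ⊢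
  refine ⟨?_, hγ.2⟩
  rcases le_or_gt 0 ((ω.expect Λ (Aᴴ * A)).re - ‖ω.expect Λ A‖ ^ 2) with hV | hV
  · exact (mul_le_mul_of_nonneg_right hle hV).trans hγ.1
  · exact (mul_neg_of_pos_of_neg hγ' hV).le.trans h0.1

/-- Applied form of `InfVolState.IsGappedGroundState.anti_holds`: a gapped ground state with gap
`γ` is a gapped ground state with any gap `0 < γ' ≤ γ`. Tasaki (2020) App. A.7, Def. A.16.
[cite: Tasaki2020, Def. A.16] -/
theorem InfVolState.IsGappedGroundState.of_gap_le {ω : InfVolState d q}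
    {Φ : LatticeInteraction d q} {R γ γ' : ℝ} (h : ω.IsGappedGroundState Φ R γ) (hγ' : 0 < γ')
    (hle : γ' ≤ γ) : ω.IsGappedGroundState Φ R γ' :=
  InfVolState.IsGappedGroundState.anti_holds h hγ' hle

end Literature.MathematicalPhysics.QuantumLattice
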